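import Summits.QuantumFields.YangMills.Theorems.BalabanLadderIRColdPurityBridge
import Summits.QuantumFields.YangMills.Theorems.BalabanLadderIRColdDoublingRecursionSC
import HarnessLib

/-!
# `BalabanLadder.IR` — helper: the «no conformal octave» dichotomy D, the windowed floored-scale budget U, and the PROVED seam D ∧ U ⇒ `FloorToPuritySC` (line `no-conformal-octave`, stmt-QuantumFields-19354)

Seat ym-ir-idea-14 g0 (planner, ideator; cell ym-ir; critic ym-ir-crit-4).  HONEST FRAMING: nothing in this file proves the
Yang–Mills mass gap (Clay), a lattice gap, or `BalabanLadder.IR`; R4 of the ladder closes only the conditional finite-𝕋⁴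
rung `BalabanLadder.UV`.  This helper file is SORRY-FREE: it lands the currency lemmas, the two statement defs and the proved seam (crit-4 PASS-WITH-PRICE
2026-08-28T03:29:31Z, RULING g9-№2); the stubs live in the crux workfile `Cruxes/IR/Lines/no_conformal_octave.lean`, NOT here.

RULE (4) VARIANT after the STRIKE of LINE 1 `entropy-staircase` (crit-4, 02:59Z: A ⟺ E ∧ A₀ because the decrement `κ`
was allowed to depend on `β`; diagnosis d1–d3: a step law has teeth only if it is UNIFORM IN β on the hot window, its
cold half must not be R, and the β-uniform crossover statement should be filed AS SUCH with its engine).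

THE STRENGTHENING.  Token attacked: **H = `FloorToPuritySC`** (the floor-to-purity handshake; `IR` then follows BY NAME from
`IR_of_handshake` with the LANDED `R = AspectBootstrap.coldDoublingRecursionSC_holds` and the inherited residual
`N = IRnsc`; the pincer's AF pin `X` is NOT used on this line).  H is β-UNIFORM (`∃ β₀ s₀ k ∀ β ≥ β₀ …`), so a per-octave
law that implies it must carry β-free constants — finiteness-per-β (crit-4 P3) cannot supply them.  S⁺ is the
per-octave DICHOTOMY above an observably floored scale («no conformal octave»):

* `NoConformalOctaveSC` (D, the load): for `β ≥ β₀`, every spacing `s ≤ s₀` and every floor height `q ≥ ε`: IF the smeared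
  truncated two-point function of the action density is floored at resolution `s`, `q ≤ Q2(β, L, s; Θv, v)` on every
  torus of physical size `s·L ≥ Λ`, THEN EITHER the floor ADVANCES one octave toward the infrared — `q + κ ≤ Q2(β, L, s/2;
  Θv, v)` on every torus with `(s/2)·L ≥ Λ`, and `q + κ` is still below a ceiling `Q` (STRUCTURE: the observable coupling
  runs, asymptotic freedom read upward) — OR from the scale `1/s` on EVERY octave of aspect-4:1 tori DISSIPATES `κ` nats of
  thermal Rényi-2 entropy `S₂(β,L) = −log(1 − δᶜ_β(L))` or is `ε₀`-cold at one of its ends (RANDOMNESS: the state purifies).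
  ONE β-free `κ = κ(G, r, v, ε, Λ, ε₀) > 0`.  At `U(1)₄` (Coulomb) D is FALSE through its own dichotomy: the photon floor
  persists at every resolution without advancing and `S₂ ≡ 2·11.81` per photon without dissipating (free-boson sums, F0);
  simplicity (`b₀ > 0`) is consumed by D itself, not by an E-component.
* `FlooredScaleBudgetSC` (U, support-sized junction to the UV rung; WINDOWED — rev 2 after crit-4's PASS-WITH-PRICE 03:29Z):
  above a floored scale the entropy is bounded in every window of `K` octaves, `S₂(β, L) ≤ S(K)` for `1/s ≤ L ≤ K/s`, with
  `S` β-free (a floored scale is not femto: `ḡ⁴(1/s) ≳ ε`; UV stability of Bałaban's programme bounds the normalised free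
  energy of a box of physical size `≤ K` EXTENSIVELY, uniformly in the cut-off — REGIME:UV; no `L`-uniform IR content).

THE INDUCTION (REAL proof `floorToPuritySC_of_dichotomy`): phase 1 — the floor can advance at most `⌈(Q−ε)/κ⌉₊` octaves
(ceiling); phase 2 — from the first non-advancing scale every octave dissipates `κ` or is cold, and `0 ≤ S₂ ≤ S` allows at
most `⌈S/κ⌉₊` dissipating octaves (the budget `S = S(2^{n_F}+1)` is invoked ONCE, at the base of the dissipating tower, inside the
window); hence an `ε₀`-pure torus of size `L' ∈ [1/s, 2^{n_F+n_E+2}/s]` — this is H with an explicit window factor `k`.  `IR_of hD hU hN := IR_of_handshake (floorToPuritySC_of_dichotomy hD hU) R_holds hN` (conditional; credits nothing).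
Card: `Cruxes/IR/Lines/no-conformal-octave.md`; verdict: `run/shared/lean/pub/ym-ir/ym-ir-crit-4/VERDICT-no-conformal-octave.md`.
-/

noncomputable section

open scoped SchwartzMap
open Literature.MathematicalPhysics.QuantumFieldTheory Literature.MathematicalPhysics.QuantumLattice
open Summit.QuantumFields.YangMills.Cruxes.OSLegsFromFemtoAndGap.DlrCollarTransfer (Q2)
open Summit.QuantumFields.YangMills.Cruxes.IR.ColdPurityBridge
open Summit.QuantumFields.YangMills.Cruxes.IR.ColdPressurePincer

namespace Summit.QuantumFields.YangMills.Cruxes.IR.NoConformalOctave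

/-! ## §1 Currency (as on line 1): thermal Rényi-2 entropy of the aspect-4:1 torus -/

section Currency

variable {G : Type} [Group G] [TopologicalSpace G] [IsTopologicalGroup G] [CompactSpace G]
  [MeasurableSpace G] [BorelSpace G]

/-- `S₂(β,L) = −log(1 − δᶜ_β(L))`. -/
def renyiTwo {N : ℕ} (ρ : G →* Matrix (Fin N) (Fin N) ℂ) (β : ℝ) (L : ℕ) : ℝ :=
  -Real.log (1 - coldDefect ρ β L)

variable [SecondCountableTopology G]

/-- `0 < 1 − δᶜ` (both partition functions are positive). -/
theorem one_sub_coldDefect_pos {N : ℕ} {ρ : G →* Matrix (Fin N) (Fin N) ℂ} (hρ : Continuous ρ) (β : ℝ) (L : ℕ) :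
    0 < 1 - coldDefect ρ β L := by
  unfold coldDefect
  have h1 := wilsonFinTorusPartition_pos hρ β L L L (2 * (L / 4))
  have h2 := wilsonFinTorusPartition_pos hρ β L L L (L / 4)
  have : 0 < wilsonFinTorusPartition ρ β L L L (2 * (L / 4)) / wilsonFinTorusPartition ρ β L L L (L / 4) ^ 2 :=
    div_pos h1 (pow_pos h2 2)
  linarith

/-- `δᶜ ≤ S₂` (from `log y ≤ y − 1`). -/
theorem coldDefect_le_renyiTwo {N : ℕ} {ρ : G →* Matrix (Fin N) (Fin N) ℂ} (hρ : Continuous ρ) (β : ℝ) (L : ℕ) :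
    coldDefect ρ β L ≤ renyiTwo ρ β L := by
  unfold renyiTwo
  have h := Real.log_le_sub_one_of_pos (one_sub_coldDefect_pos hρ β L)
  linarith

/-- `0 ≤ S₂` for `β ≥ 0`, `L ≥ 8` (reflection positivity: `Z(2t) ≤ Z(t)²`, tree `coldDefect_nonneg`). -/
theorem renyiTwo_nonneg {N : ℕ} {ρ : G →* Matrix (Fin N) (Fin N) ℂ} (hρ : Continuous ρ)
    (hρu : ∀ g, ρ g ∈ Matrix.unitaryGroup (Fin N) ℂ) {β : ℝ} (hβ : 0 ≤ β) {L : ℕ} (hL : 8 ≤ L) :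
    0 ≤ renyiTwo ρ β L := by
  haveI : NeZero L := ⟨by omega⟩
  have h0 : 0 ≤ coldDefect ρ β L := by
    unfold coldDefect
    exact Summit.QuantumFields.YangMills.Theorems.DoublingDefect.coldDefect_nonneg hρ hρu hβ L (L / 4) (by omega)
  exact h0.trans (coldDefect_le_renyiTwo hρ β L)

end Currency

/-! ## §2 The strengthening: a β-uniform per-octave dichotomy above a floored scale (two stubs, D the load) -/

/-- **D — `NoConformalOctaveSC` (the LOAD; XL; β-UNIFORM).**  For compact simple simply-connected `G`, every `r`, every real
positive-time test function `v`, floor height `ε > 0`, physical threshold `Λ` and tolerance `ε₀ > 0` there are β-FREE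
constants `κ > 0` (quantum of progress per octave), `Q` (observable ceiling), `β₀`, `s₀ > 0` such that for all `β ≥ β₀`,
all spacings `0 < s ≤ s₀` and all heights `q ≥ ε`: a floor `q ≤ Q2(β,L,s;Θv,v)` on every torus with `s·L ≥ Λ` forces
EITHER (structure) `q + κ ≤ Q` and the floor `q + κ` one octave up (`Q2(β,L,s/2;Θv,v)` on every torus with `(s/2)·L ≥ Λ`),
OR (dissipation) for every `L ≥ 1/s`, `L ≥ 8`: `δᶜ_β(L) ≤ ε₀ ∨ δᶜ_β(2L) ≤ ε₀ ∨ S₂(β,2L) ≤ S₂(β,L) − κ`.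
Why it might fail: an approximately CONFORMAL window — octaves in which the observable coupling is stationary AND the
aspect-4 entropy is scale-stationary (an infrared fixed point / walking regime of the `SU(N)` Wilson theory, or a lattice
bulk critical point) — makes a β-free `κ` impossible; exactly this happens at `U(1)₄` (free photon: floor constant,
`S₂` constant) — a proof must use `b₀ > 0` (non-abelian running) and `π₁ = 1`.
Sources: Luscher–Sommer–Weisz–Wolff NPB 413 (1994) 481 (SF step scaling `σ(u) > u`, SU(2)); Boyd et al. hep-lat/9602007
(`(ε−3p)/T⁴ > 0`); Luscher NPB 219 (1983) 233; `Literature.Barriers.QuantumFields.AbelianDeconfinementD4`; census B7. -/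
def NoConformalOctaveSC : Prop :=
  ∀ (G : Type) [Group G] [TopologicalSpace G] [IsTopologicalGroup G] [CompactSpace G],
    IsCompactSimpleLieGroup G → SimplyConnectedSpace G →
    letI : MeasurableSpace G := borel G
    haveI : BorelSpace G := ⟨rfl⟩
    ∀ (r : LatticeRep G) (v : 𝓢(EuclideanSpace ℝ (Fin 4), ℝ)),
      tsupport v ⊆ {y : EuclideanSpace ℝ (Fin 4) | 0 < y 0} →
      ∀ (ε Λ ε₀ : ℝ), 0 < ε → 0 < ε₀ →
        ∃ (κ Q β₀ s₀ : ℝ), 0 < κ ∧ 0 < s₀ ∧ ∀ β : ℝ, β₀ ≤ β → ∀ s : ℝ, 0 < s → s ≤ s₀ → ∀ q : ℝ, ε ≤ q →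
          (∀ L : ℕ, Λ ≤ s * L → q ≤ Q2 G r β L s (thetaTest 4 v) v) →
            (q + κ ≤ Q ∧ ∀ L : ℕ, Λ ≤ s / 2 * L → q + κ ≤ Q2 G r β L (s / 2) (thetaTest 4 v) v) ∨
            (∀ L : ℕ, 1 / s ≤ (L : ℝ) → 8 ≤ L →
              coldDefect r.ρ β L ≤ ε₀ ∨ coldDefect r.ρ β (2 * L) ≤ ε₀ ∨
                renyiTwo r.ρ β (2 * L) ≤ renyiTwo r.ρ β L - κ)

/-- **U — `FlooredScaleBudgetSC` (support-sized; the junction to the UV rung; WINDOWED per crit-4 03:29Z).**  Above a floored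
scale the thermal Rényi-2 entropy of the aspect-4:1 tori in a window of `K` octaves is bounded β-uniformly: for every window factor
`K`, for `β ≥ β₀`, `0 < s ≤ s₀`, a floor `ε ≤ Q2(β,L,s;Θv,v)` on all tori with `s·L ≥ Λ` gives `S₂(β,L) ≤ S` for every
`1/s ≤ L ≤ K/s`, `L ≥ 8`, with `S = S(G,r,v,ε,Λ,K)` β-free (REGIME:UV — an EXTENSIVE stability bound `S₂ ≤ c·(sL)⁴ ≤ c K⁴` at physical
volume `≤ K⁴` suffices; no `L`-uniform (infrared) content).
Content: a floored scale is not femto (`Q2 ≍ ḡ⁴(1/s) ≥ ε` pins `1/s ≳ c_ε/Λ_{YM}` lattice units), and on boxes of fixed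
physical size UV stability bounds the normalised free energies `|log Z − bulk| ≤ c·(physical volume)` uniformly in the
cut-off (Bałaban CMP 1985–89 — the conditional rung `BalabanLadder.UV`), whence `S₂ = 2 log Z(t) − log Z(2t) − bulk·0 ≤ 4c·K⁴`.
Why it might fail: only if the femto entropy `(d_tor/3)·log(1/ḡ²)` were reachable at a floored scale, i.e. if the floor did
not pin the physical size from below (it does when `Q2 ≍ ḡ⁴`; a floor carried by lattice artefacts at `s ≫ a(β)` is
excluded by `s ≤ s₀` only if `s₀` may depend on `ε` — it may).  Sources: Balaban CMP 109 (1987) 249, CMP 122 (1989) 355;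
Luscher NPB 219 (1983) 233; van Baal–Koller Ann. Phys. 174 (1987) 299. -/
def FlooredScaleBudgetSC : Prop :=
  ∀ (G : Type) [Group G] [TopologicalSpace G] [IsTopologicalGroup G] [CompactSpace G],
    IsCompactSimpleLieGroup G → SimplyConnectedSpace G →
    letI : MeasurableSpace G := borel G
    haveI : BorelSpace G := ⟨rfl⟩
    ∀ (r : LatticeRep G) (v : 𝓢(EuclideanSpace ℝ (Fin 4), ℝ)),
      tsupport v ⊆ {y : EuclideanSpace ℝ (Fin 4) | 0 < y 0} →
      ∀ (ε Λ : ℝ), 0 < ε → ∀ K : ℝ,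
        ∃ (S β₀ s₀ : ℝ), 0 < s₀ ∧ ∀ β : ℝ, β₀ ≤ β → ∀ s : ℝ, 0 < s → s ≤ s₀ →
          (∀ L : ℕ, Λ ≤ s * L → ε ≤ Q2 G r β L s (thetaTest 4 v) v) →
            ∀ L : ℕ, 1 / s ≤ (L : ℝ) → (L : ℝ) ≤ K / s → 8 ≤ L → renyiTwo r.ρ β L ≤ S

/-! ## §3 The induction on octaves (REAL proofs) -/

section Induction

variable {G : Type} [Group G] [TopologicalSpace G] [IsTopologicalGroup G] [CompactSpace G]
  [MeasurableSpace G] [BorelSpace G] [SecondCountableTopology G]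

omit [SecondCountableTopology G] in
/-- Phase 2 bookkeeping: along a dyadic tower on which every octave is cold-or-dissipating, if no rung up to `n` is cold
then `S₂` has dropped by `n κ`. -/
theorem renyiTwo_le_sub_mul_of_noCold {N : ℕ} (ρ : G →* Matrix (Fin N) (Fin N) ℂ) (β : ℝ) {κ ε₀ M : ℝ} {Lb : ℕ}
    (hM : M ≤ (Lb : ℝ)) (h8 : 8 ≤ Lb)
    (hdis : ∀ L : ℕ, M ≤ (L : ℝ) → 8 ≤ L →
      coldDefect ρ β L ≤ ε₀ ∨ coldDefect ρ β (2 * L) ≤ ε₀ ∨ renyiTwo ρ β (2 * L) ≤ renyiTwo ρ β L - κ)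
    (n : ℕ) (hno : ∀ i : ℕ, i ≤ n → ¬ (coldDefect ρ β (2 ^ i * Lb) ≤ ε₀ ∨ coldDefect ρ β (2 * (2 ^ i * Lb)) ≤ ε₀)) :
    renyiTwo ρ β (2 ^ n * Lb) ≤ renyiTwo ρ β Lb - n * κ := by
  induction n with
  | zero => simp
  | succ n ih =>
    have ih' := ih (fun i hi => hno i (Nat.le_succ_of_le hi))
    have hpow : (1 : ℕ) ≤ 2 ^ n := Nat.one_le_two_pow
    have hL8 : 8 ≤ 2 ^ n * Lb := le_trans h8 (Nat.le_mul_of_pos_left Lb (Nat.two_pow_pos n))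
    have hLM : M ≤ ((2 ^ n * Lb : ℕ) : ℝ) := by
      refine hM.trans ?_
      exact_mod_cast Nat.le_mul_of_pos_left Lb (Nat.two_pow_pos n)
    rcases hdis (2 ^ n * Lb) hLM hL8 with hc | hc | hdec
    · exact absurd (Or.inl hc) (hno n (Nat.le_succ n))
    · exact absurd (Or.inr hc) (hno n (Nat.le_succ n))
    · have h2 : 2 * (2 ^ n * Lb) = 2 ^ (n + 1) * Lb := by ring
      rw [h2] at hdec
      have : ((n + 1 : ℕ) : ℝ) * κ = (n : ℝ) * κ + κ := by push_cast; ring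
      rw [this]
      linarith

end Induction

/-- **D ∧ U ⇒ H (REAL proof — the induction on octaves above the floored scale).** -/
theorem floorToPuritySC_of_dichotomy (hD : NoConformalOctaveSC) (hU : FlooredScaleBudgetSC) : FloorToPuritySC := by
  intro G _ _ _ _ hG hsc
  letI : MeasurableSpace G := borel G
  haveI : BorelSpace G := ⟨rfl⟩
  intro r v hv ε Λ ε₀ hε hε₀
  haveI : SecondCountableTopology G :=
    (r.continuous.isClosedEmbedding r.injective).isEmbedding.secondCountableTopology
  obtain ⟨κ, Q, β₀D, s₀D, hκ, hs₀D, hDβ⟩ := hD G hG hsc r v hv ε Λ ε₀ hε hε₀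
  -- octave counts: at most `nF − 1` advances (ceiling), then the windowed budget at `K := 2^nF + 1`, at most `nE − 1` dissipations
  set nF : ℕ := ⌈(Q - ε) / κ⌉₊ + 1 with hnF
  obtain ⟨S, β₀U, s₀U, hs₀U, hUβ⟩ := hU G hG hsc r v hv ε Λ hε ((2 : ℝ) ^ nF + 1)
  set nE : ℕ := ⌈S / κ⌉₊ + 1 with hnE
  refine ⟨max (max β₀D β₀U) 0, min (min s₀D s₀U) (1 / 8), (2 : ℝ) ^ (nF + nE + 2), ?_, ?_⟩
  · exact lt_min (lt_min hs₀D hs₀U) (by norm_num)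
  intro β hβ s hs hss₀ hfloor
  have hβD : β₀D ≤ β := le_trans (le_trans (le_max_left _ _) (le_max_left _ _)) hβ
  have hβU : β₀U ≤ β := le_trans (le_trans (le_max_right _ _) (le_max_left _ _)) hβ
  have hβ0 : 0 ≤ β := le_trans (le_max_right _ _) hβ
  have hsD : s ≤ s₀D := le_trans hss₀ (le_trans (min_le_left _ _) (min_le_left _ _))
  have hsU : s ≤ s₀U := le_trans hss₀ (le_trans (min_le_left _ _) (min_le_right _ _))
  have hs8 : s ≤ 1 / 8 := le_trans hss₀ (min_le_right _ _)
  have hs1 : s ≤ 1 := hs8.trans (by norm_num)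
  have h8s : (8 : ℝ) ≤ 1 / s := by
    rw [le_div_iff₀ hs]; calc (8 : ℝ) * s ≤ 8 * (1 / 8) := by gcongr
      _ = 1 := by norm_num
  -- the dissipation predicate from scale `M` on
  let Dis : ℝ → Prop := fun M => ∀ L : ℕ, M ≤ (L : ℝ) → 8 ≤ L →
    coldDefect r.ρ β L ≤ ε₀ ∨ coldDefect r.ρ β (2 * L) ≤ ε₀ ∨ renyiTwo r.ρ β (2 * L) ≤ renyiTwo r.ρ β L - κ
  -- PHASE 1: some octave `j ≤ nF` above the floored scale does not advance, hence dissipates from `2^j / s` on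
  have phase1 : ∃ j : ℕ, j ≤ nF ∧ Dis (2 ^ j / s) := by
    by_contra hno
    push Not at hno
    -- then the floor advances `nF` times and stays below the ceiling
    have adv : ∀ j : ℕ, j ≤ nF →
        (∀ L : ℕ, Λ ≤ s / 2 ^ j * L → ε + j * κ ≤ Q2 G r β L (s / 2 ^ j) (thetaTest 4 v) v) ∧
        (1 ≤ j → ε + j * κ ≤ Q) := by
      intro j
      induction j with
      | zero =>
        intro _
        refine ⟨?_, fun h => absurd h (by norm_num)⟩
        intro L hL
        simpa using hfloor L (by simpa using hL)
      | succ j ih =>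
        intro hj
        have hj' : j ≤ nF := Nat.le_of_succ_le hj
        obtain ⟨hflj, -⟩ := ih hj'
        have hsj : 0 < s / 2 ^ j := div_pos hs (pow_pos (by norm_num) j)
        have hsj' : s / 2 ^ j ≤ s₀D := by
          refine le_trans ?_ hsD
          exact div_le_self hs.le (one_le_pow₀ (by norm_num))
        have hq : ε ≤ ε + j * κ := by
          have : (0 : ℝ) ≤ j * κ := mul_nonneg (Nat.cast_nonneg j) hκ.le
          linarith
        rcases hDβ β hβD (s / 2 ^ j) hsj hsj' (ε + j * κ) hq hflj with ⟨hQ, hfl⟩ | hdis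
        · have hs2 : s / 2 ^ j / 2 = s / 2 ^ (j + 1) := by rw [pow_succ]; ring
          have hq2 : ε + j * κ + κ = ε + ((j + 1 : ℕ) : ℝ) * κ := by push_cast; ring
          refine ⟨?_, fun _ => ?_⟩
          · intro L hL
            have := hfl L (by rwa [hs2])
            rwa [hs2, hq2] at this
          · rwa [hq2] at hQ
        · exact absurd (fun L hL h8 => hdis L (by rw [one_div_div]; exact hL) h8) (hno j hj')
    -- contradiction with the ceiling at `j = nF`
    obtain ⟨-, hQ⟩ := adv nF le_rfl
    have hQ' := hQ (by simp [hnF])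
    have hceil : (Q - ε) / κ ≤ (⌈(Q - ε) / κ⌉₊ : ℝ) := Nat.le_ceil _
    have hnFr : ((nF : ℕ) : ℝ) = (⌈(Q - ε) / κ⌉₊ : ℝ) + 1 := by simp [hnF]
    have : (Q - ε) / κ * κ = Q - ε := div_mul_cancel₀ _ hκ.ne'
    have h1 : (Q - ε) + κ ≤ (nF : ℝ) * κ := by
      rw [hnFr, add_mul, one_mul]
      have := mul_le_mul_of_nonneg_right hceil hκ.le
      rw [div_mul_cancel₀ _ hκ.ne'] at this
      linarith
    linarith
  obtain ⟨j₁, hj₁, hdis⟩ := phase1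
  -- PHASE 2: dyadic tower over `Lb := ⌈2^{j₁}/s⌉₊`
  set Lb : ℕ := ⌈(2 : ℝ) ^ j₁ / s⌉₊ with hLb
  have hpos2 : (0 : ℝ) < 2 ^ j₁ := pow_pos (by norm_num) j₁
  have hMle : (2 : ℝ) ^ j₁ / s ≤ Lb := Nat.le_ceil _
  have h1s : 1 / s ≤ (2 : ℝ) ^ j₁ / s := by
    gcongr; exact one_le_pow₀ (by norm_num)
  have hLb1 : 1 / s ≤ (Lb : ℝ) := h1s.trans hMle
  have hLb8 : 8 ≤ Lb := by exact_mod_cast (h8s.trans hLb1)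
  have hLbup : (Lb : ℝ) ≤ 2 ^ j₁ / s + 1 := (Nat.ceil_lt_add_one (div_nonneg hpos2.le hs.le)).le
  -- budget at the base of the tower (inside the window `Lb ≤ (2^nF + 1)/s`)
  have hLbK : (Lb : ℝ) ≤ (2 ^ nF + 1) / s := by
    have hj' : (2 : ℝ) ^ j₁ ≤ 2 ^ nF := pow_le_pow_right₀ (by norm_num) hj₁
    have h1s' : (1 : ℝ) ≤ 1 / s := by rw [le_div_iff₀ hs]; linarith
    calc (Lb : ℝ) ≤ 2 ^ j₁ / s + 1 := hLbup
      _ ≤ 2 ^ nF / s + 1 / s := by gcongr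
      _ = (2 ^ nF + 1) / s := by ring
  have hS : renyiTwo r.ρ β Lb ≤ S := hUβ β hβU s hs hsU hfloor Lb hLb1 hLbK hLb8
  -- some rung `i ≤ nE` is cold
  have phase2 : ∃ i : ℕ, i ≤ nE ∧
      (coldDefect r.ρ β (2 ^ i * Lb) ≤ ε₀ ∨ coldDefect r.ρ β (2 * (2 ^ i * Lb)) ≤ ε₀) := by
    by_contra hno
    push Not at hno
    have hdrop := renyiTwo_le_sub_mul_of_noCold r.ρ β hMle hLb8 hdis nE
      (fun i hi h => by rcases h with h | h <;> [exact absurd h (not_le.mpr (hno i hi).1); exact absurd h (not_le.mpr (hno i hi).2)])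
    have hL8 : 8 ≤ 2 ^ nE * Lb := le_trans hLb8 (Nat.le_mul_of_pos_left Lb (Nat.two_pow_pos nE))
    have hnn := renyiTwo_nonneg r.continuous r.mem_unitary hβ0 hL8
    have hceil : S / κ ≤ (⌈S / κ⌉₊ : ℝ) := Nat.le_ceil _
    have hnEr : ((nE : ℕ) : ℝ) = (⌈S / κ⌉₊ : ℝ) + 1 := by simp [hnE]
    have h1 : S + κ ≤ (nE : ℝ) * κ := by
      rw [hnEr, add_mul, one_mul]
      have := mul_le_mul_of_nonneg_right hceil hκ.le
      rw [div_mul_cancel₀ _ hκ.ne'] at this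
      linarith
    linarith
  obtain ⟨i, hi, hcold⟩ := phase2
  -- the window bound: `2 · 2^i · Lb ≤ 2^(nF+nE+2) / s`
  have hwin : (2 : ℝ) * (2 ^ i * Lb) ≤ 2 ^ (nF + nE + 2) / s := by
    have hi' : (2 : ℝ) ^ i ≤ 2 ^ nE := pow_le_pow_right₀ (by norm_num) hi
    have hj' : (2 : ℝ) ^ j₁ ≤ 2 ^ nF := pow_le_pow_right₀ (by norm_num) hj₁
    have hone : (1 : ℝ) ≤ 2 ^ nF / s := by
      rw [le_div_iff₀ hs]
      calc (1 : ℝ) * s = s := one_mul s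
        _ ≤ 1 := hs1
        _ ≤ 2 ^ nF := one_le_pow₀ (by norm_num)
    have hLb' : (Lb : ℝ) ≤ 2 ^ nF / s + 2 ^ nF / s := by
      calc (Lb : ℝ) ≤ 2 ^ j₁ / s + 1 := hLbup
        _ ≤ 2 ^ nF / s + 2 ^ nF / s := by gcongr
    calc (2 : ℝ) * (2 ^ i * Lb) ≤ 2 * (2 ^ nE * (2 ^ nF / s + 2 ^ nF / s)) := by gcongr
      _ = 2 ^ (nF + nE + 2) / s := by ring
  have hLbi1 : 1 / s ≤ ((2 ^ i * Lb : ℕ) : ℝ) := by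
    refine hLb1.trans ?_
    exact_mod_cast Nat.le_mul_of_pos_left Lb (Nat.two_pow_pos i)
  have hLbi8 : 8 ≤ 2 ^ i * Lb := le_trans hLb8 (Nat.le_mul_of_pos_left Lb (Nat.two_pow_pos i))
  rcases hcold with hc | hc
  · refine ⟨2 ^ i * Lb, hLbi8, hLbi1, ?_, hc⟩
    have h0 : (0 : ℝ) ≤ 2 ^ i * (Lb : ℝ) := by positivity
    calc ((2 ^ i * Lb : ℕ) : ℝ) = 2 ^ i * (Lb : ℝ) := by push_cast; ring
      _ ≤ 2 * (2 ^ i * (Lb : ℝ)) := by linarith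
      _ ≤ 2 ^ (nF + nE + 2) / s := hwin
  · refine ⟨2 * (2 ^ i * Lb), by omega, ?_, ?_, hc⟩
    · refine hLbi1.trans ?_
      exact_mod_cast Nat.le_mul_of_pos_left (2 ^ i * Lb) (by norm_num)
    · calc ((2 * (2 ^ i * Lb) : ℕ) : ℝ) = 2 * (2 ^ i * (Lb : ℝ)) := by push_cast; ring
        _ ≤ 2 ^ (nF + nE + 2) / s := hwin

/-! ## §4 The composition concluding the crux BY NAME (conditional on D, U, N; no stubs in this file) -/

/-- **The composition (kernel-checked, no sorry of its own): D → U → N → `BalabanLadder.IR`**, with the landed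
`R = AspectBootstrap.coldDoublingRecursionSC_holds` (p596893) and the tree's `IR_of_handshake` BY NAME. -/
theorem IR_of (hD : NoConformalOctaveSC) (hU : FlooredScaleBudgetSC) (hN : IRnsc) :
    Summit.QuantumFields.YangMills.Theses.BalabanLadder.IR :=
  IR_of_handshake (floorToPuritySC_of_dichotomy hD hU)
    Summit.QuantumFields.YangMills.Cruxes.IR.AspectBootstrap.coldDoublingRecursionSC_holds hN

end Summit.QuantumFields.YangMills.Cruxes.IR.NoConformalOctave

end
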